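/-
Copyright (c) 2026 the pub-hodgecm-mathlib formalisation cell (harness21).  Prover seat hodgecm-mathlib-K2E4-p01 (g3), Track B ∕ K2-LIT,
h413 = `stmt-HodgeConjecture-24833`; road «#22S ⟸ (GS_v) + (LIFT_v)», FILE W = the two RANK-TWO WITNESSES of (GS^P).  2026-09-04.
-/
import Summits.HodgeConjecture.HodgeConjecture.Theorems.K2E3GLTwoRamifiedRayGermEngine   -- ★ FILE E (this seat): the explicit germ; transitively FILES A B1 B2 C1 C2 (lineage g2)
import HarnessLib

/-!
# h413 ∕ Track B «K2-LIT» — FILE W: the two RANK-TWO WITNESSES `ψ₁ = 1_{(z·1₂,c)·K_P}`, `ψ₂ = ψ₁ − 1_{(z·1₂,c)·(K(ϖ) × GL₁(𝒪))}`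
# of the central germ structure (GS^P) on `P = GL₂(F) × GL₁(F)`: their shell values along the ramified ray at depth one

Cell `pub/hodgecm-mathlib`, crux H413 = `stmt-HodgeConjecture-24833` (supports-only); #22S road F-C1 (K2E4-plan (g2) RULING (B) 00:28:50Z).
The rank-two clause of (GS^P) (`K2/K2E4-p01/g3/GSP.sig.lean` v2) asks for two test functions whose germ pairs `(a, b)` along the ray
`γ_n = z(1 + ϖⁿτ)` are linearly independent.  THIS FILE computes everything about the two witnesses that the engine ★ FILE E
`orbitalIntegral_deep_eq_closedForm` consumes (pure algebra over the valued field `F`, no measure):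

* §1 `coe_scalarInv_mul`, `coe_normShellConj_one` — the normalised shell conjugates `M_r := (z·1₂)⁻¹ · r_r⁻¹ γ_1 r_r = (1, ϖ^{r+1}v; ϖ·ϖ^{-r}, 1 + ϖu)`;
  `normShellConj_one_one_mem_glInt`, `normShellConj_one_one_not_mem_congruenceGL` (`M_1 = (1, ϖ²v; 1, 1+ϖu) ∈ GL₂(𝒪) ∖ K(ϖ)`),
  `normShellConj_one_not_mem_glInt` (`M_r ∉ GL₂(𝒪)` for `r ≥ 2`: the entry `ϖ^{1−r}`), `scalarInv_mul_deep_one_mem` (`M_0 ∈ K(ϖ)`, ★ FILE A).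
* §2 the witnesses as functions of `y ↦ ((z·1₂, c)⁻¹ y ∈ K_P ?)`, `(… ∈ K(ϖ) × GL₁(𝒪) ?)`: smoothness is left to the main file (topology); here:
  `K_P`-conjugation invariance (`K(ϖ) ⊴ GL₂(𝒪)`, ★ FILE E), right-`K(ϖ)`-invariance in the `GL₂` variable, the central values `1 ∕ 0`, and the
  SHELL VALUES at depth one: `ψ₁ : 1, 1, 0, 0, …`, `ψ₂ : 0, 1, 0, 0, …` — whence `S_1(ψ₁) = 1 + q`, `S_1(ψ₂) = q` in FILE E's closed form and the
  germ pairs `(a₁, b₁) = (−w∕(q−1), wq∕(q−1))`, `(a₂, b₂) = (0, w)` with `a₁b₂ − a₂b₁ = −w²∕(q−1) ≠ 0` (main file).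

HONEST LABEL: HC_CM is proved only modulo the 7 printed citations (2 remaining named inputs: hLiu418 = `stmt-HodgeConjecture-24832`,
h413 = `stmt-HodgeConjecture-24833`) until rung 0 closes; this file is elementary and moves no counter by itself.

## References
* [LabesseLanglands1979] J.-P. Labesse, R. P. Langlands, *L-indistinguishability for SL(2)*, Canad. J. Math. 31 (1979), §2 pp. 7–9.
* [Rogawski1990] J. D. Rogawski, *Automorphic Representations of Unitary Groups in Three Variables* (1990), §8.1 pp. 114–116; §4.9 p. 55.
-/

set_option autoImplicit false
set_option linter.dupNamespace false

noncomputable section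

open scoped ValuativeRel Matrix MatrixGroups
open Matrix ValuativeRel
open Literature.NumberTheory.Automorphic Literature.NumberTheory.Automorphic.HermitianLatticeTree
open Summit.HodgeConjecture.HodgeConjecture.Cruxes.H413.K2E3GLTwoRamifiedShellShift
open Summit.HodgeConjecture.HodgeConjecture.Cruxes.H413.K2E3GLTwoRamifiedShellStabilizers
open Summit.HodgeConjecture.HodgeConjecture.Cruxes.H413.K2E3GLTwoRamifiedShellUnfolding
open Summit.HodgeConjecture.HodgeConjecture.Cruxes.H413.K2E3GLTwoRamifiedRayGermEngine

namespace Summit.HodgeConjecture.HodgeConjecture.Cruxes.H413.K2E3GLTwoRamifiedRayRankTwo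

variable {F : Type*} [Field F] [ValuativeRel F] {ϖ : F} (hϖ : IsUniformizingElement ϖ)

/-! ## §1 The normalised shell conjugates `M_r = (z·1₂)⁻¹ r_r⁻¹ γ_1 r_r` at depth one -/

section Matrices

omit [ValuativeRel F] in
/-- `(z·1₂)⁻¹ · g = z⁻¹ • g` on matrices. [folklore] -/
theorem coe_scalarInv_mul {z : F} (hz : z ≠ 0) {zS : GL (Fin 2) F} (hzS : (zS : Matrix (Fin 2) (Fin 2) F) = !![z, 0; 0, z]) (g : GL (Fin 2) F) :
    ((zS⁻¹ * g : GL (Fin 2) F) : Matrix (Fin 2) (Fin 2) F) = z⁻¹ • (g : Matrix (Fin 2) (Fin 2) F) := by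
  have hinv : ((zS⁻¹ : GL (Fin 2) F) : Matrix (Fin 2) (Fin 2) F) = !![z⁻¹, 0; 0, z⁻¹] := by
    refine Units.inv_eq_of_mul_eq_one_right ?_
    rw [hzS]
    ext i j
    fin_cases i <;> fin_cases j <;> simp [Matrix.mul_apply, Fin.sum_univ_two, mul_inv_cancel₀ hz]
  rw [Units.val_mul, hinv]
  ext i j
  fin_cases i <;> fin_cases j <;> simp [Matrix.mul_apply, Fin.sum_univ_two]

include hϖ in
/-- **The normalised shell conjugate at depth one**: `(z·1₂)⁻¹ · r_r⁻¹ γ_1 r_r = (1, ϖ v ϖ^r; ϖ (ϖ^r)⁻¹, 1 + ϖ u)` (★ `coe_inv_mul_torus_mul_of_coe_eq_diagonal`).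
[cite: LabesseLanglands1979, §2 (2.1) p. 8] -/
theorem coe_normShellConj_one {u v : F} (z : Fˣ)
    {γ : ℕ → GL (Fin 2) F} (hγ : ∀ n, (γ n : Matrix (Fin 2) (Fin 2) F) = !![(z : F), z * ϖ ^ n * v; z * ϖ ^ n, z + z * ϖ ^ n * u])
    {rm : ℕ → GL (Fin 2) F} (hrm : ∀ m, (rm m : Matrix (Fin 2) (Fin 2) F) = Matrix.diagonal ![1, ϖ ^ m])
    {zS : GL (Fin 2) F} (hzS : (zS : Matrix (Fin 2) (Fin 2) F) = !![(z : F), 0; 0, z]) (r : ℕ) :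
    ((zS⁻¹ * ((rm r)⁻¹ * γ 1 * rm r) : GL (Fin 2) F) : Matrix (Fin 2) (Fin 2) F) = !![1, ϖ * v * ϖ ^ r; ϖ * (ϖ ^ r)⁻¹, 1 + ϖ * u] := by
  have hr0 : ϖ ^ r ≠ 0 := pow_ne_zero _ hϖ.ne_zero
  have hγ1 : (γ 1 : Matrix (Fin 2) (Fin 2) F) = !![(z : F), z * ϖ * v; z * ϖ, z + z * ϖ * u] := by rw [hγ 1, pow_one]
  rw [coe_scalarInv_mul z.ne_zero hzS, coe_inv_mul_torus_mul_of_coe_eq_diagonal u v (z : F) (z * ϖ) hγ1 (hrm r) hr0]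
  ext i j
  fin_cases i <;> fin_cases j <;> simp <;> field_simp

include hϖ in
/-- `M_0 = (z·1₂)⁻¹ γ_1 ∈ K(ϖ)` (★ FILE A `exists_deep_eq_scalar_mul_of_mem_congruenceGL`). [cite: LabesseLanglands1979, §2 p. 8] -/
theorem scalarInv_mul_deep_one_mem {u v : F} (hu : u ∈ 𝒪[F]) (hv : v ∈ 𝒪[F]) (z : F)
    {γ : ℕ → GL (Fin 2) F} (hγ : ∀ n, (γ n : Matrix (Fin 2) (Fin 2) F) = !![z, z * ϖ ^ n * v; z * ϖ ^ n, z + z * ϖ ^ n * u])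
    {zS : GL (Fin 2) F} (hzS : (zS : Matrix (Fin 2) (Fin 2) F) = !![z, 0; 0, z]) :
    zS⁻¹ * γ 1 ∈ congruenceGL 2 (valuation F ϖ ^ 1) := by
  obtain ⟨k, hk, hγk⟩ := exists_deep_eq_scalar_mul_of_mem_congruenceGL hϖ hu hv z le_rfl (hγ 1) hzS
  rw [hγk, inv_mul_cancel_left]
  exact hk

include hϖ in
/-- `M_1 = (1, ϖ²v; 1, 1 + ϖu) ∈ GL₂(𝒪)`: integral entries and unit determinant `1 + ϖu − ϖ²v` (★ FILE A `valuation_deepDet_eq_one`).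
[cite: LabesseLanglands1979, §2 p. 8] -/
theorem normShellConj_one_one_mem_glInt {u v : F} (hu : u ∈ 𝒪[F]) (hv : v ∈ 𝒪[F]) (z : Fˣ)
    {γ : ℕ → GL (Fin 2) F} (hγ : ∀ n, (γ n : Matrix (Fin 2) (Fin 2) F) = !![(z : F), z * ϖ ^ n * v; z * ϖ ^ n, z + z * ϖ ^ n * u])
    {rm : ℕ → GL (Fin 2) F} (hrm : ∀ m, (rm m : Matrix (Fin 2) (Fin 2) F) = Matrix.diagonal ![1, ϖ ^ m])
    {zS : GL (Fin 2) F} (hzS : (zS : Matrix (Fin 2) (Fin 2) F) = !![(z : F), 0; 0, z]) :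
    zS⁻¹ * ((rm 1)⁻¹ * γ 1 * rm 1) ∈ glInt 2 F := by
  have h0 := hϖ.ne_zero
  have hM : ((zS⁻¹ * ((rm 1)⁻¹ * γ 1 * rm 1) : GL (Fin 2) F) : Matrix (Fin 2) (Fin 2) F) = !![1, ϖ * v * ϖ; 1, 1 + ϖ * u] := by
    rw [coe_normShellConj_one hϖ z hγ hrm hzS 1, pow_one, mul_inv_cancel₀ h0]
  have hϖO : ϖ ∈ 𝒪[F] := hϖ.mem
  refine mem_glInt_of_isIntegralMatrix (fun i j => ?_) ?_
  · rw [hM]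
    fin_cases i <;> fin_cases j
    · simp
    · simpa using Subring.mul_mem _ (Subring.mul_mem _ hϖO hv) hϖO
    · simp
    · simpa using Subring.add_mem _ (Subring.one_mem _) (Subring.mul_mem _ hϖO hu)
  · rw [hM, Matrix.det_fin_two_of]
    have h := valuation_deepDet_eq_one hϖ hu hv (n := 1) le_rfl
    rw [pow_one, show 2 * 1 = 2 from rfl] at h
    rw [show (1 : F) * (1 + ϖ * u) - ϖ * v * ϖ * 1 = 1 + ϖ * u - ϖ ^ 2 * v by ring]
    exact h

include hϖ in
/-- `M_1 ∉ K(ϖ)`: its `(1,0)` entry is `1`, so `(M_1 − 1)₁₀ = 1` has valuation `1 > |ϖ|`. [cite: LabesseLanglands1979, §2 p. 8] -/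
theorem normShellConj_one_one_not_mem_congruenceGL {u v : F} (z : Fˣ)
    {γ : ℕ → GL (Fin 2) F} (hγ : ∀ n, (γ n : Matrix (Fin 2) (Fin 2) F) = !![(z : F), z * ϖ ^ n * v; z * ϖ ^ n, z + z * ϖ ^ n * u])
    {rm : ℕ → GL (Fin 2) F} (hrm : ∀ m, (rm m : Matrix (Fin 2) (Fin 2) F) = Matrix.diagonal ![1, ϖ ^ m])
    {zS : GL (Fin 2) F} (hzS : (zS : Matrix (Fin 2) (Fin 2) F) = !![(z : F), 0; 0, z]) :
    zS⁻¹ * ((rm 1)⁻¹ * γ 1 * rm 1) ∉ congruenceGL 2 (valuation F ϖ ^ 1) := by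
  intro h
  have h10 := (mem_congruenceGL_iff.1 h).2.1 1 0
  rw [coe_normShellConj_one hϖ z hγ hrm hzS 1, pow_one, mul_inv_cancel₀ hϖ.ne_zero] at h10
  simp only [Matrix.sub_apply, Matrix.one_apply_ne (show (1 : Fin 2) ≠ 0 by decide), sub_zero, Matrix.of_apply, Matrix.cons_val',
    Matrix.cons_val_zero, Matrix.cons_val_one, Matrix.cons_val_fin_one, map_one] at h10
  exact not_lt.2 h10 (by rw [pow_one]; exact hϖ.valuation_lt_one)

include hϖ in
/-- `M_r ∉ GL₂(𝒪)` for `r ≥ 2`: the `(1,0)` entry `ϖ·ϖ^{−r}` has valuation `|ϖ|^{1−r} > 1`. [cite: LabesseLanglands1979, §2 p. 8] -/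
theorem normShellConj_one_not_mem_glInt {u v : F} (z : Fˣ)
    {γ : ℕ → GL (Fin 2) F} (hγ : ∀ n, (γ n : Matrix (Fin 2) (Fin 2) F) = !![(z : F), z * ϖ ^ n * v; z * ϖ ^ n, z + z * ϖ ^ n * u])
    {rm : ℕ → GL (Fin 2) F} (hrm : ∀ m, (rm m : Matrix (Fin 2) (Fin 2) F) = Matrix.diagonal ![1, ϖ ^ m])
    {zS : GL (Fin 2) F} (hzS : (zS : Matrix (Fin 2) (Fin 2) F) = !![(z : F), 0; 0, z]) {r : ℕ} (hr : 2 ≤ r) :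
    zS⁻¹ * ((rm r)⁻¹ * γ 1 * rm r) ∉ glInt 2 F := by
  intro h
  have h10 := ((mem_glInt_iff _).1 h).1 1 0
  rw [coe_normShellConj_one hϖ z hγ hrm hzS r] at h10
  simp only [Matrix.of_apply, Matrix.cons_val', Matrix.cons_val_zero, Matrix.cons_val_one, Matrix.cons_val_fin_one] at h10
  rw [Valuation.mem_integer_iff, map_mul, map_inv₀, map_pow] at h10
  have h0 : valuation F ϖ ≠ 0 := (Valuation.ne_zero_iff _).2 hϖ.ne_zero
  have hϖ1 := hϖ.valuation_lt_one
  -- `|ϖ| · |ϖ|^{-r} ≤ 1` would give `|ϖ| ≤ |ϖ|^r ≤ |ϖ|^2 < |ϖ|`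
  have h1 : valuation F ϖ ≤ valuation F ϖ ^ r := by
    have := mul_le_mul' h10 (le_refl (valuation F ϖ ^ r))
    rwa [mul_assoc, inv_mul_cancel₀ (pow_ne_zero _ h0), mul_one, one_mul] at this
  have h2 : valuation F ϖ ^ r < valuation F ϖ := by
    calc valuation F ϖ ^ r ≤ valuation F ϖ ^ 2 := pow_le_pow_right_of_le_one' hϖ1.le hr
      _ < valuation F ϖ := by rw [pow_two]; exact mul_lt_of_lt_one_left (zero_lt_iff.2 h0) hϖ1
  exact absurd (h1.trans_lt h2) (lt_irrefl _)

end Matrices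

/-! ## §2 The witnesses as functions: invariances, central values and shell values at depth one -/

section Witnesses

variable {u v : F} (z : Fˣ) (cu : GL (Fin 1) F)
  {γ : ℕ → GL (Fin 2) F} {rm : ℕ → GL (Fin 2) F} {zS : GL (Fin 2) F}
  (A B : ℂ)

/-- The generic witness `ψ_{A,B}(y) = A·[ (z·1₂,c)⁻¹y ∈ K_P ] + B·[ (z·1₂,c)⁻¹y ∈ K(ϖ) × GL₁(𝒪) ]` (Iverson brackets), of which `ψ₁ = ψ_{1,0}` and
`ψ₂ = ψ_{1,−1}`; here ABBREVIATED through its defining membership tests (the main file instantiates it as a difference of indicators).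
**`K_P`-conjugation invariance of both membership tests** (`(z·1₂, c)` central; `K(ϖ) × GL₁(𝒪) ⊴ K_P`, ★ FILE E `conj_mem_congruenceGL_of_mem_glInt`).
[cite: LabesseLanglands1979, §2 p. 7] -/
theorem mem_tests_conj_iff (hcomm : ∀ x : GL (Fin 2) F × GL (Fin 1) F, ((zS, cu) : GL (Fin 2) F × GL (Fin 1) F) * x = x * (zS, cu))
    {k : GL (Fin 2) F × GL (Fin 1) F} (hk : k ∈ (glInt 2 F).prod (glInt 1 F)) (y : GL (Fin 2) F × GL (Fin 1) F) (δ : ValueGroupWithZero F) :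
    (((zS, cu) : GL (Fin 2) F × GL (Fin 1) F)⁻¹ * (k * y * k⁻¹) ∈ (glInt 2 F).prod (glInt 1 F) ↔
        ((zS, cu) : GL (Fin 2) F × GL (Fin 1) F)⁻¹ * y ∈ (glInt 2 F).prod (glInt 1 F)) ∧
      (((zS, cu) : GL (Fin 2) F × GL (Fin 1) F)⁻¹ * (k * y * k⁻¹) ∈ (congruenceGL 2 δ).prod (glInt 1 F) ↔
        ((zS, cu) : GL (Fin 2) F × GL (Fin 1) F)⁻¹ * y ∈ (congruenceGL 2 δ).prod (glInt 1 F)) := by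
  have hc' : ((zS, cu) : GL (Fin 2) F × GL (Fin 1) F)⁻¹ * k = k * ((zS, cu) : GL (Fin 2) F × GL (Fin 1) F)⁻¹ := by
    rw [inv_mul_eq_iff_eq_mul, ← mul_assoc, hcomm k, mul_assoc, mul_inv_cancel, mul_one]
  have hcentral : ((zS, cu) : GL (Fin 2) F × GL (Fin 1) F)⁻¹ * (k * y * k⁻¹) = k * (((zS, cu) : GL (Fin 2) F × GL (Fin 1) F)⁻¹ * y) * k⁻¹ := by
    calc ((zS, cu) : GL (Fin 2) F × GL (Fin 1) F)⁻¹ * (k * y * k⁻¹)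
        = (((zS, cu) : GL (Fin 2) F × GL (Fin 1) F)⁻¹ * k) * y * k⁻¹ := by group
      _ = (k * ((zS, cu) : GL (Fin 2) F × GL (Fin 1) F)⁻¹) * y * k⁻¹ := by rw [hc']
      _ = k * (((zS, cu) : GL (Fin 2) F × GL (Fin 1) F)⁻¹ * y) * k⁻¹ := by group
  rw [hcentral]
  obtain ⟨hk1, hk2⟩ := Subgroup.mem_prod.1 hk
  constructor
  · constructor
    · intro h
      have := Subgroup.mul_mem _ (Subgroup.mul_mem _ (Subgroup.inv_mem _ hk) h) hk
      simpa only [← mul_assoc, inv_mul_cancel, one_mul, inv_mul_cancel_right] using this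
    · intro h
      exact Subgroup.mul_mem _ (Subgroup.mul_mem _ hk h) (Subgroup.inv_mem _ hk)
  · set w := ((zS, cu) : GL (Fin 2) F × GL (Fin 1) F)⁻¹ * y with hw
    constructor
    · intro h
      obtain ⟨h1, h2⟩ := Subgroup.mem_prod.1 h
      refine Subgroup.mem_prod.2 ⟨?_, ?_⟩
      · have := conj_mem_congruenceGL_of_mem_glInt (Subgroup.inv_mem _ hk1) h1
        simpa only [Prod.fst_mul, Prod.fst_inv, inv_inv, ← mul_assoc, inv_mul_cancel, one_mul, inv_mul_cancel_right] using this
      · have := Subgroup.mul_mem _ (Subgroup.mul_mem _ (Subgroup.inv_mem _ hk2) h2) hk2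
        simpa only [Prod.snd_mul, Prod.snd_inv, ← mul_assoc, inv_mul_cancel, one_mul, inv_mul_cancel_right] using this
    · intro h
      obtain ⟨h1, h2⟩ := Subgroup.mem_prod.1 h
      refine Subgroup.mem_prod.2 ⟨?_, ?_⟩
      · simpa only [Prod.fst_mul, Prod.fst_inv] using conj_mem_congruenceGL_of_mem_glInt hk1 h1
      · simpa only [Prod.snd_mul, Prod.snd_inv] using Subgroup.mul_mem _ (Subgroup.mul_mem _ hk2 h2) (Subgroup.inv_mem _ hk2)

/-- **Right-`K(ϖ)`-invariance of both membership tests in the `GL₂` variable** (level one). [cite: LabesseLanglands1979, §2 p. 8] -/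
theorem mem_tests_mul_right_iff {δ : ValueGroupWithZero F} {k : GL (Fin 2) F} (hk : k ∈ congruenceGL 2 δ) (x : GL (Fin 2) F) :
    (((zS, cu) : GL (Fin 2) F × GL (Fin 1) F)⁻¹ * (x * k, cu) ∈ (glInt 2 F).prod (glInt 1 F) ↔
        ((zS, cu) : GL (Fin 2) F × GL (Fin 1) F)⁻¹ * (x, cu) ∈ (glInt 2 F).prod (glInt 1 F)) ∧
      (((zS, cu) : GL (Fin 2) F × GL (Fin 1) F)⁻¹ * (x * k, cu) ∈ (congruenceGL 2 δ).prod (glInt 1 F) ↔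
        ((zS, cu) : GL (Fin 2) F × GL (Fin 1) F)⁻¹ * (x, cu) ∈ (congruenceGL 2 δ).prod (glInt 1 F)) := by
  simp only [Prod.inv_mk, Prod.mk_mul_mk, Subgroup.mem_prod, ← mul_assoc]
  exact ⟨and_congr_left' (Subgroup.mul_mem_cancel_right _ (congruenceGL_le_glInt δ hk)),
    and_congr_left' (Subgroup.mul_mem_cancel_right _ hk)⟩

/-- **The membership tests at the centre**: `(z·1₂, c)⁻¹(z·1₂, c) = 1` lies in both subgroups. [folklore] -/
theorem mem_tests_centre (δ : ValueGroupWithZero F) :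
    ((zS, cu) : GL (Fin 2) F × GL (Fin 1) F)⁻¹ * (zS, cu) ∈ (glInt 2 F).prod (glInt 1 F) ∧
      ((zS, cu) : GL (Fin 2) F × GL (Fin 1) F)⁻¹ * (zS, cu) ∈ (congruenceGL 2 δ).prod (glInt 1 F) := by
  rw [inv_mul_cancel]
  exact ⟨Subgroup.one_mem _, Subgroup.one_mem _⟩

include hϖ in
/-- **THE SHELL VALUES OF THE MEMBERSHIP TESTS AT DEPTH ONE**: along the shell conjugates `y_r = X_r (γ_1, c) X_r⁻¹`, the test «`∈ K_P`» reads
`true, true, false, false, …` and the test «`∈ K(ϖ) × GL₁(𝒪)`» reads `true, false, false, …` (§1). [cite: LabesseLanglands1979, §2 p. 8] -/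
theorem mem_tests_shellConj_one (hu : u ∈ 𝒪[F]) (hv : v ∈ 𝒪[F])
    (hγ : ∀ n, (γ n : Matrix (Fin 2) (Fin 2) F) = !![(z : F), z * ϖ ^ n * v; z * ϖ ^ n, z + z * ϖ ^ n * u])
    (hrm : ∀ m, (rm m : Matrix (Fin 2) (Fin 2) F) = Matrix.diagonal ![1, ϖ ^ m])
    (hzS : (zS : Matrix (Fin 2) (Fin 2) F) = !![(z : F), 0; 0, z]) (r : ℕ) :
    (((zS, cu) : GL (Fin 2) F × GL (Fin 1) F)⁻¹ *
          ((((rm r)⁻¹, 1) : GL (Fin 2) F × GL (Fin 1) F) * (γ 1, cu) * (((rm r)⁻¹, 1) : GL (Fin 2) F × GL (Fin 1) F)⁻¹) ∈ (glInt 2 F).prod (glInt 1 F) ↔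
        r ≤ 1) ∧
      (((zS, cu) : GL (Fin 2) F × GL (Fin 1) F)⁻¹ *
          ((((rm r)⁻¹, 1) : GL (Fin 2) F × GL (Fin 1) F) * (γ 1, cu) * (((rm r)⁻¹, 1) : GL (Fin 2) F × GL (Fin 1) F)⁻¹) ∈
          (congruenceGL 2 (valuation F ϖ ^ 1)).prod (glInt 1 F) ↔
        r = 0) := by
  have hXconj : (((rm r)⁻¹, 1) : GL (Fin 2) F × GL (Fin 1) F) * (γ 1, cu) * (((rm r)⁻¹, 1) : GL (Fin 2) F × GL (Fin 1) F)⁻¹ =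
      ((rm r)⁻¹ * γ 1 * rm r, cu) := by
    simp only [Prod.mk_mul_mk, Prod.inv_mk, inv_inv, one_mul, inv_one, mul_one]
  rw [hXconj]
  simp only [Prod.inv_mk, Prod.mk_mul_mk, inv_mul_cancel, Subgroup.mem_prod, Subgroup.one_mem, and_true]
  have h0mem : zS⁻¹ * γ 1 ∈ congruenceGL 2 (valuation F ϖ ^ 1) := scalarInv_mul_deep_one_mem hϖ hu hv (z : F) hγ hzS
  have hrm0 : rm 0 = 1 := Units.ext (by rw [hrm, pow_zero, Units.val_one, ← Matrix.diagonal_one]; congr 1; funext i; fin_cases i <;> rfl)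
  rcases Nat.lt_or_ge r 2 with hr | hr
  · interval_cases r
    · rw [hrm0, inv_one, one_mul, mul_one]
      exact ⟨iff_of_true (congruenceGL_le_glInt _ h0mem) (by omega), iff_of_true h0mem rfl⟩
    · exact ⟨iff_of_true (normShellConj_one_one_mem_glInt hϖ hu hv z hγ hrm hzS) le_rfl,
        iff_of_false (normShellConj_one_one_not_mem_congruenceGL hϖ z hγ hrm hzS) (by omega)⟩
  · have hnot := normShellConj_one_not_mem_glInt hϖ z hγ hrm hzS hr
    exact ⟨iff_of_false hnot (by omega), iff_of_false (fun h => hnot (congruenceGL_le_glInt _ h)) (by omega)⟩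

end Witnesses

end Summit.HodgeConjecture.HodgeConjecture.Cruxes.H413.K2E3GLTwoRamifiedRayRankTwo

end
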